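import Mathlib.Topology.Algebra.OpenSubgroup
import Mathlib.LinearAlgebra.Span.Basic
import Mathlib.Algebra.Module.LinearMap.End
import Mathlib.Algebra.BigOperators.Group.Finset.Basic
import Mathlib.Algebra.BigOperators.GroupWithZero.Action
import Mathlib.Algebra.Module.BigOperators
import Mathlib.Algebra.Order.BigOperators.Group.Finset
import Mathlib.Tactic.Linarith
import Mathlib.Tactic.Ring
import Mathlib.Topology.Algebra.Group.Compact
import HarnessLib

/-!
# Non-zero smooth modules over a self-dual lattice group have a non-zero twisted stalk

This file isolates the harmonic-analysis step of the Bernstein–Zelevinsky / Gelfand–Kazhdan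
proof that supercuspidal representations of `GL_n(F)` are generic ("existence of derivatives",
Bernstein–Zelevinsky 1976, §5; for `n = 2` Bump 1997, §4.4, the sheaf `𝒮(V)` of a smooth
`N(F)`-module, Propositions 4.3.12–4.3.13 and 4.4.5 and Theorem 4.4.3): a smooth representation of
the additive group `A = F^m` is a non-degenerate module over `C_c^∞(Â)`, hence a cosheaf on the
dual group `Â ≅ F^m`, and a non-zero cosheaf has a non-zero costalk; the costalk at the character
`χ_b` is the space of twisted coinvariants `V / V(A, χ_b)`,
`V(A, χ_b) = ⟨ρ(x) u - χ_b(x) u⟩` (Bump 1997, p. 462: `V_{N,ψ}`; Prop. 4.4.5).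

We prove the statement in an abstract, Haar-measure-free form suitable for the column groups of
the unipotent radical of `GL_n(F)`. The input is a `StalkDatum`: an additive group `A` with a
monotone exhaustive `ℤ`-indexed chain of subgroups `L s` ("lattices", of finite index in each
other), a topological additive group `B` of parameters with characters `χ b : A → k`
(bi-additive, nowhere zero), the annihilators `D s = {b | χ b = 1 on L s}` (compact and open in
`B`), and the **separation property** `x ∉ L s ⇒ ∃ b ∈ D s, χ b x ≠ 1` (biduality of lattices,
which for `F^m` is elementary: Bump 1997, Exercise 3.1.1; Weil, *Basic Number Theory*, II §5).
The output (`StalkDatum.exists_notMem_sup_twistedSpan`): for an additive action `ρ` of `A` on a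
`k`-vector space `V` (`char k = 0`) which is smooth (every vector is fixed by some `L s`), a
`ρ`-stable subspace `W` and a vector `v ∉ W`, there is a parameter `b` with
`v ∉ W + ⟨ρ(x) u - χ_b(x) u⟩`; i.e. the quotient `V / W` has a non-zero `χ_b`-costalk.

Proof (finite Fourier analysis, cf. Bump 1997, proof of Prop. 4.4.1 and of Thm. 4.4.3): let
`e^{(r)}_b v = ∑_{q ∈ L r / L s} χ_b(-q̃) ρ(q̃) v` be the twisted average (`L s` fixing `v`).
(i) If `v ∈ W + V(A, χ_b)` then `e^{(r)}_b v ∈ W` for all large `r` (the easy half of the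
Jacquet–Langlands lemma, Bump Prop. 4.4.1 / (4.21), plus independence of the small lattice);
(ii) `e^{(r')}_b e^{(r)}_b v = [L r : L s] e^{(r')}_b v`, so the sets
`U_r = {b | e^{(r)}_b v ∈ W}` increase with `r`; they are `D r`-saturated, hence open, and cover the
compact `D s`, so `D s ⊆ U_R` for one `R`; (iii) finite Fourier inversion on `D s / D R` (the
separation property kills the coset representatives `q̃ ∉ L s`) gives
`∑_{b ∈ D s / D R} e^{(R)}_b v = [D s : D R] v ∈ W`, contradiction.

The file contains the structure `StalkDatum`, the definition `StalkDatum.twistedAverage` and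
theorems; no named facts, no instances, no `sorry`.

## References

* D. Bump, *Automorphic Forms and Representations*, Cambridge Stud. Adv. Math. 55 (1997), §4.3
  (cosmooth modules and sheaves, Props. 4.3.12–4.3.13) and §4.4, pp. 460–466 of the held copy
  (Prop. 4.4.1, the twisted Jacquet module `J_ψ`, Prop. 4.4.5, Thm. 4.4.3). [Bump1997]
* I. N. Bernstein, A. V. Zelevinsky, *Representations of the group `GL(n, F)` where `F` is a
  non-archimedean local field*, Russian Math. Surveys 31:3 (1976), 1–68, §1 (l-sheaves) and §5.
  [BernsteinZelevinsky1976]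
-/

open scoped Pointwise Topology

namespace Literature.NumberTheory.Automorphic

/-- **Stalk datum**: the lattice/character data of an additive group `A` "in duality with" a
topological additive group `B` through characters `χ b : A → k`. Fields: `χ` bi-additive and
nowhere zero; a monotone, exhaustive `ℤ`-chain of subgroups `L s ≤ A` with finite successive
quotients; subgroups `D s ≤ B` which are exactly the annihilators of the `L s`, compact and open;
and the separation (biduality) property `x ∉ L s ⇒ ∃ b ∈ D s, χ b x ≠ 1`. The model is
`A = B = F^m` for a non-archimedean local field `F`, `χ b x = ψ(b · x)`, `L s = ϖ^{-s} 𝒪^m`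
(Bump 1997, §4.4, the self-duality `a ↦ ψ_a` of `F`, Exercise 3.1.1). [folklore] -/
structure StalkDatum (k A B : Type*) [Field k] [AddCommGroup A] [AddCommGroup B]
    [TopologicalSpace B] where
  /-- The characters `χ b : A → k`, `b ∈ B`. -/
  χ : B → A → k
  /-- The lattices `L s ≤ A`, `s ∈ ℤ`. -/
  L : ℤ → AddSubgroup A
  /-- The annihilators `D s = {b | χ b = 1 on L s} ≤ B`. -/
  D : ℤ → AddSubgroup B
  χ_add_left : ∀ b b' x, χ (b + b') x = χ b x * χ b' x
  χ_add_right : ∀ b x y, χ b (x + y) = χ b x * χ b y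
  χ_ne_zero : ∀ b x, χ b x ≠ 0
  mono : Monotone L
  exhaust : ∀ x, ∃ r, x ∈ L r
  finite_quotient : ∀ r s, Finite (L r ⧸ (L s).addSubgroupOf (L r))
  mem_D_iff : ∀ s b, b ∈ D s ↔ ∀ x ∈ L s, χ b x = 1
  isCompact_D : ∀ s, IsCompact (D s : Set B)
  isOpen_D : ∀ s, IsOpen (D s : Set B)
  sep : ∀ s x, x ∉ L s → ∃ b ∈ D s, χ b x ≠ 1

namespace StalkDatum

variable {k A B : Type*} [Field k] [AddCommGroup A] [AddCommGroup B] [TopologicalSpace B]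
  (𝒟 : StalkDatum k A B)

/-! ### Algebra of the characters -/

/-- `χ b 0 = 1`. [folklore] -/
theorem χ_zero_right (b : B) : 𝒟.χ b 0 = 1 := by
  have h := 𝒟.χ_add_right b 0 0
  rw [add_zero] at h
  exact (mul_eq_left₀ (𝒟.χ_ne_zero b 0)).1 h.symm

/-- `χ 0 x = 1`. [folklore] -/
theorem χ_zero_left (x : A) : 𝒟.χ 0 x = 1 := by
  have h := 𝒟.χ_add_left 0 0 x
  rw [add_zero] at h
  exact (mul_eq_left₀ (𝒟.χ_ne_zero 0 x)).1 h.symm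

/-- `χ b (-x) χ b x = 1`. [folklore] -/
theorem χ_neg_mul (b : B) (x : A) : 𝒟.χ b (-x) * 𝒟.χ b x = 1 := by
  rw [← 𝒟.χ_add_right, neg_add_cancel, 𝒟.χ_zero_right]

/-- `χ b (-x) = (χ b x)⁻¹`. [folklore] -/
theorem χ_neg (b : B) (x : A) : 𝒟.χ b (-x) = (𝒟.χ b x)⁻¹ :=
  eq_inv_of_mul_eq_one_left (𝒟.χ_neg_mul b x)

/-- The annihilators decrease as the lattices increase. [folklore] -/
theorem D_anti {s s' : ℤ} (h : s' ≤ s) : 𝒟.D s ≤ 𝒟.D s' := fun b hb =>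
  (𝒟.mem_D_iff s' b).2 fun x hx => (𝒟.mem_D_iff s b).1 hb x (𝒟.mono h hx)

/-- `0 ∈ L s`-cosets: membership of an annihilator on an element of the lattice. [folklore] -/
theorem χ_eq_one_of_mem_D {s : ℤ} {b : B} (hb : b ∈ 𝒟.D s) {x : A} (hx : x ∈ 𝒟.L s) :
    𝒟.χ b x = 1 :=
  (𝒟.mem_D_iff s b).1 hb x hx

/-! ### Twisted averages -/

section Action

variable {V : Type*} [AddCommGroup V] [Module k V] (ρ : A → V →ₗ[k] V)

/-- The **twisted average** `e^{(r)}_{s,b} v = ∑_{q ∈ L r / L s} χ b (-q̃) • ρ(q̃) v` over coset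
representatives `q̃ = q.out` (a finite sum: the quotients `L r / L s` are finite). This is the
Haar-measure-free form of `∫_{L r} χ_b(x)⁻¹ ρ(x) v dx` (Bump 1997, (4.21)). [folklore] -/
noncomputable def twistedAverage (r s : ℤ) (b : B) (v : V) : V :=
  haveI := @Fintype.ofFinite (𝒟.L r ⧸ (𝒟.L s).addSubgroupOf (𝒟.L r)) (𝒟.finite_quotient r s)
  ∑ q : 𝒟.L r ⧸ (𝒟.L s).addSubgroupOf (𝒟.L r),
    𝒟.χ b (-((q.out : 𝒟.L r) : A)) • ρ ((q.out : 𝒟.L r) : A) v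

/-- Unfolding of `twistedAverage` for any `Fintype` structure on the quotient. [folklore] -/
theorem twistedAverage_eq (r s : ℤ) (b : B) (v : V)
    [Fintype (𝒟.L r ⧸ (𝒟.L s).addSubgroupOf (𝒟.L r))] :
    𝒟.twistedAverage ρ r s b v = ∑ q : 𝒟.L r ⧸ (𝒟.L s).addSubgroupOf (𝒟.L r),
      𝒟.χ b (-((q.out : 𝒟.L r) : A)) • ρ ((q.out : 𝒟.L r) : A) v := by
  rw [twistedAverage]
  exact Finset.sum_congr (by congr; exact Subsingleton.elim _ _) fun _ _ => rfl

section Algebra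

/-- If `L s` fixes `v`, then `ρ a v` only depends on `a` modulo `L s`. [folklore] -/
theorem apply_eq_of_quotient_eq (hρ : ∀ x y, ρ (x + y) = ρ x ∘ₗ ρ y) {r s : ℤ} {v : V}
    (hv : ∀ x ∈ 𝒟.L s, ρ x v = v)
    {a a' : 𝒟.L r} (h : (a : 𝒟.L r ⧸ (𝒟.L s).addSubgroupOf (𝒟.L r)) = a') :
    ρ (a : A) v = ρ (a' : A) v := by
  have hmem : -(a : A) + a' ∈ 𝒟.L s := by
    have := QuotientAddGroup.eq.1 h
    rw [AddSubgroup.mem_addSubgroupOf] at this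
    simpa using this
  calc ρ (a : A) v = ρ (a : A) (ρ (-(a : A) + a') v) := by rw [hv _ hmem]
    _ = ρ (a' : A) v := by rw [← LinearMap.comp_apply, ← hρ, add_neg_cancel_left]

/-- If `b ∈ D s`, then `χ b a` only depends on `a` modulo `L s`. [folklore] -/
theorem χ_eq_of_quotient_eq {r s : ℤ} {b : B} (hb : b ∈ 𝒟.D s)
    {a a' : 𝒟.L r} (h : (a : 𝒟.L r ⧸ (𝒟.L s).addSubgroupOf (𝒟.L r)) = a') :
    𝒟.χ b (a : A) = 𝒟.χ b (a' : A) := by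
  have hmem : -(a : A) + a' ∈ 𝒟.L s := by
    have := QuotientAddGroup.eq.1 h
    rw [AddSubgroup.mem_addSubgroupOf] at this
    simpa using this
  have := 𝒟.χ_eq_one_of_mem_D hb hmem
  rw [𝒟.χ_add_right, 𝒟.χ_neg] at this
  rwa [inv_mul_eq_one₀ (𝒟.χ_ne_zero _ _)] at this

/-- The action of `A` is commutative: `ρ x (ρ y v) = ρ y (ρ x v)`. [folklore] -/
theorem apply_comm (hρ : ∀ x y, ρ (x + y) = ρ x ∘ₗ ρ y) (x y : A) (v : V) :
    ρ x (ρ y v) = ρ y (ρ x v) := by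
  rw [← LinearMap.comp_apply, ← hρ, add_comm, hρ, LinearMap.comp_apply]

/-- **Equivariance of the twisted average**: for `y ∈ L r`, `v` fixed by `L s` and `b ∈ D s`,
`e(ρ y v) = χ b y • e v` (translation by `y` permutes `L r / L s`). This is the computation
behind "`π(u) v - ψ_N(u) v` has vanishing twisted integral" (Bump 1997, proof of Prop. 4.4.1).
[folklore] -/
theorem twistedAverage_apply (hρ : ∀ x y, ρ (x + y) = ρ x ∘ₗ ρ y) {r s : ℤ} {b : B}
    (hb : b ∈ 𝒟.D s) {v : V} (hv : ∀ x ∈ 𝒟.L s, ρ x v = v) {y : A} (hy : y ∈ 𝒟.L r) :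
    𝒟.twistedAverage ρ r s b (ρ y v) = 𝒟.χ b y • 𝒟.twistedAverage ρ r s b v := by
  haveI := @Fintype.ofFinite _ (𝒟.finite_quotient r s)
  rw [𝒟.twistedAverage_eq, 𝒟.twistedAverage_eq, Finset.smul_sum]
  refine Fintype.sum_equiv (Equiv.addRight ((⟨y, hy⟩ : 𝒟.L r) : 𝒟.L r ⧸ _)) _ _ fun q => ?_
  rw [Equiv.coe_addRight]
  set q' := q + ((⟨y, hy⟩ : 𝒟.L r) : 𝒟.L r ⧸ (𝒟.L s).addSubgroupOf (𝒟.L r)) with hq'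
  have hcl : ((q.out + ⟨y, hy⟩ : 𝒟.L r) : 𝒟.L r ⧸ (𝒟.L s).addSubgroupOf (𝒟.L r)) = q'.out := by
    rw [QuotientAddGroup.mk_add, QuotientAddGroup.out_eq', QuotientAddGroup.out_eq']
  have h1 : ρ ((q.out : 𝒟.L r) : A) (ρ y v) = ρ ((q'.out : 𝒟.L r) : A) v := by
    rw [← LinearMap.comp_apply, ← hρ]
    exact 𝒟.apply_eq_of_quotient_eq ρ hρ hv hcl
  have h2 : 𝒟.χ b (-((q.out : 𝒟.L r) : A)) = 𝒟.χ b y * 𝒟.χ b (-((q'.out : 𝒟.L r) : A)) := by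
    have := 𝒟.χ_eq_of_quotient_eq (r := r) hb hcl
    rw [AddSubgroup.coe_add, 𝒟.χ_add_right] at this
    rw [𝒟.χ_neg, 𝒟.χ_neg, ← this, mul_inv, mul_left_comm, mul_inv_cancel₀ (𝒟.χ_ne_zero _ _),
      mul_one]
  rw [h1, h2, mul_smul]

/-- The twisted average of an `L s`-fixed vector is `(L r, χ b)`-equivariant:
`ρ y (e v) = χ b y • e v` for `y ∈ L r`. [folklore] -/
theorem apply_twistedAverage (hρ : ∀ x y, ρ (x + y) = ρ x ∘ₗ ρ y) {r s : ℤ} {b : B}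
    (hb : b ∈ 𝒟.D s) {v : V} (hv : ∀ x ∈ 𝒟.L s, ρ x v = v) {y : A} (hy : y ∈ 𝒟.L r) :
    ρ y (𝒟.twistedAverage ρ r s b v) = 𝒟.χ b y • 𝒟.twistedAverage ρ r s b v := by
  rw [← 𝒟.twistedAverage_apply ρ hρ hb hv hy]
  haveI := @Fintype.ofFinite _ (𝒟.finite_quotient r s)
  rw [𝒟.twistedAverage_eq, 𝒟.twistedAverage_eq, map_sum]
  refine Finset.sum_congr rfl fun q _ => ?_
  rw [map_smul, apply_comm ρ hρ]

/-- Twisted averaging of a `(L r, χ b)`-equivariant vector over `L r / L s'` multiplies it by the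
number of cosets. [folklore] -/
theorem twistedAverage_of_equivariant {r s' : ℤ} {b : B} {u : V}
    (hu : ∀ y ∈ 𝒟.L r, ρ y u = 𝒟.χ b y • u)
    [Fintype (𝒟.L r ⧸ (𝒟.L s').addSubgroupOf (𝒟.L r))] :
    𝒟.twistedAverage ρ r s' b u = Fintype.card (𝒟.L r ⧸ (𝒟.L s').addSubgroupOf (𝒟.L r)) • u := by
  rw [𝒟.twistedAverage_eq, ← Finset.card_univ, ← Finset.sum_const]
  refine Finset.sum_congr rfl fun q _ => ?_
  rw [hu _ (q.out).2, smul_smul, 𝒟.χ_neg_mul, one_smul]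

/-- **Independence of the small lattice.** If `v` is fixed by `L s`, `s' ≤ s` and `b ∈ D s`,
then `[L r : L s'] • e_{r,s} v = [L r : L s] • e_{r,s'} v`: the normalised twisted averages over
`L r / L s` and over `L r / L s'` agree (twisted-average the `(L r, χ b)`-equivariant vector
`e_{r,s} v` over `L r / L s'` and expand). [folklore] -/
theorem card_smul_twistedAverage_comm (hρ : ∀ x y, ρ (x + y) = ρ x ∘ₗ ρ y) {r s s' : ℤ}
    (hs : s' ≤ s) {b : B} (hb : b ∈ 𝒟.D s) {v : V} (hv : ∀ x ∈ 𝒟.L s, ρ x v = v)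
    [Fintype (𝒟.L r ⧸ (𝒟.L s).addSubgroupOf (𝒟.L r))]
    [Fintype (𝒟.L r ⧸ (𝒟.L s').addSubgroupOf (𝒟.L r))] :
    Fintype.card (𝒟.L r ⧸ (𝒟.L s').addSubgroupOf (𝒟.L r)) • 𝒟.twistedAverage ρ r s b v =
      Fintype.card (𝒟.L r ⧸ (𝒟.L s).addSubgroupOf (𝒟.L r)) • 𝒟.twistedAverage ρ r s' b v := by
  have hb' : b ∈ 𝒟.D s' := 𝒟.D_anti hs hb
  have hv' : ∀ x ∈ 𝒟.L s', ρ x v = v := fun x hx => hv x (𝒟.mono hs hx)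
  -- twisted-average `e_{r,s} v` over `L r / L s'`
  have key := 𝒟.twistedAverage_of_equivariant ρ (r := r) (s' := s')
    (fun y hy => 𝒟.apply_twistedAverage ρ hρ hb hv hy)
  rw [← key, 𝒟.twistedAverage_eq ρ r s', 𝒟.twistedAverage_eq ρ r s]
  simp_rw [map_sum, map_smul, Finset.smul_sum]
  rw [Finset.sum_comm]
  rw [← 𝒟.twistedAverage_of_equivariant ρ (r := r) (s' := s)
    (fun y hy => 𝒟.apply_twistedAverage ρ hρ hb' hv' hy), 𝒟.twistedAverage_eq ρ r s]
  refine Finset.sum_congr rfl fun q _ => ?_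
  rw [𝒟.twistedAverage_eq ρ r s', map_sum, Finset.smul_sum]
  refine Finset.sum_congr rfl fun q' _ => ?_
  rw [map_smul, smul_comm, apply_comm ρ hρ]

/-- **Monotonicity in the big lattice.** For `s ≤ r ≤ r'`, `b ∈ D s` and `v` fixed by `L s`:
`e_{r',s}(e_{r,s} v) = [L r : L s] • e_{r',s} v`. [folklore] -/
theorem twistedAverage_twistedAverage (hρ : ∀ x y, ρ (x + y) = ρ x ∘ₗ ρ y) {r r' s : ℤ}
    (hr : r ≤ r') {b : B} (hb : b ∈ 𝒟.D s) {v : V} (hv : ∀ x ∈ 𝒟.L s, ρ x v = v)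
    [Fintype (𝒟.L r ⧸ (𝒟.L s).addSubgroupOf (𝒟.L r))] :
    𝒟.twistedAverage ρ r' s b (𝒟.twistedAverage ρ r s b v) =
      Fintype.card (𝒟.L r ⧸ (𝒟.L s).addSubgroupOf (𝒟.L r)) • 𝒟.twistedAverage ρ r' s b v := by
  haveI := @Fintype.ofFinite _ (𝒟.finite_quotient r' s)
  have hequiv : ∀ y ∈ 𝒟.L r, ρ y (𝒟.twistedAverage ρ r' s b v) =
      𝒟.χ b y • 𝒟.twistedAverage ρ r' s b v :=
    fun y hy => 𝒟.apply_twistedAverage ρ hρ hb hv (𝒟.mono hr hy)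
  rw [← 𝒟.twistedAverage_of_equivariant ρ (r := r) (s' := s) hequiv, 𝒟.twistedAverage_eq ρ r s,
    𝒟.twistedAverage_eq ρ r s, 𝒟.twistedAverage_eq ρ r' s]
  simp_rw [map_sum, map_smul, Finset.smul_sum]
  rw [Finset.sum_comm]
  refine Finset.sum_congr rfl fun q _ => ?_
  rw [𝒟.twistedAverage_eq ρ r' s, map_sum, Finset.smul_sum]
  refine Finset.sum_congr rfl fun p _ => ?_
  rw [map_smul, smul_comm, apply_comm ρ hρ]

/-- The twisted average only depends on `b` modulo `D r`. [folklore] -/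
theorem twistedAverage_add_of_mem_D {r s : ℤ} {b d : B} (hd : d ∈ 𝒟.D r) (v : V) :
    𝒟.twistedAverage ρ r s (b + d) v = 𝒟.twistedAverage ρ r s b v := by
  haveI := @Fintype.ofFinite _ (𝒟.finite_quotient r s)
  rw [𝒟.twistedAverage_eq, 𝒟.twistedAverage_eq]
  refine Finset.sum_congr rfl fun q _ => ?_
  rw [𝒟.χ_add_left, 𝒟.χ_eq_one_of_mem_D hd ((𝒟.L r).neg_mem (q.out).2), mul_one]

/-- A `ρ`-stable subspace is stable under twisted averages. [folklore] -/
theorem twistedAverage_mem {W : Submodule k V} (hW : ∀ x, ∀ w ∈ W, ρ x w ∈ W) (r s : ℤ) (b : B)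
    {w : V} (hw : w ∈ W) : 𝒟.twistedAverage ρ r s b w ∈ W := by
  haveI := @Fintype.ofFinite _ (𝒟.finite_quotient r s)
  rw [𝒟.twistedAverage_eq]
  exact W.sum_mem fun q _ => W.smul_mem _ (hW _ _ hw)

/-- **The easy half of the Jacquet–Langlands lemma** (Bump 1997, Prop. 4.4.1, first half of the
proof, twisted form (4.21)): every element of `V(A, χ b) = ⟨ρ(x) u - χ b x • u⟩` is killed by the
twisted averages over all sufficiently large lattices modulo all sufficiently small ones.
[cite: Bump1997, Proposition 4.4.1 (PDF p. 460)] -/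
theorem exists_twistedAverage_eq_zero (hρ : ∀ x y, ρ (x + y) = ρ x ∘ₗ ρ y)
    (hsm : ∀ v : V, ∃ s, ∀ x ∈ 𝒟.L s, ρ x v = v) (b : B)
    {t : V} (ht : t ∈ Submodule.span k {w | ∃ x u, w = ρ x u - 𝒟.χ b x • u}) :
    ∃ r₀ s₀ : ℤ, ∀ r, r₀ ≤ r → ∀ s', s' ≤ s₀ → b ∈ 𝒟.D s' → 𝒟.twistedAverage ρ r s' b t = 0 := by
  induction ht using Submodule.span_induction with
  | mem w hw =>
    obtain ⟨x, u, rfl⟩ := hw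
    obtain ⟨r₀, hr₀⟩ := 𝒟.exhaust x
    obtain ⟨s₀, hs₀⟩ := hsm u
    refine ⟨r₀, s₀, fun r hr s' hs' hb => ?_⟩
    haveI := @Fintype.ofFinite _ (𝒟.finite_quotient r s')
    have hu : ∀ y ∈ 𝒟.L s', ρ y u = u := fun y hy => hs₀ y (𝒟.mono hs' hy)
    have h1 := 𝒟.twistedAverage_apply ρ hρ hb hu (𝒟.mono hr hr₀)
    have h2 : 𝒟.twistedAverage ρ r s' b (𝒟.χ b x • u) = 𝒟.χ b x • 𝒟.twistedAverage ρ r s' b u := by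
      rw [𝒟.twistedAverage_eq, 𝒟.twistedAverage_eq, Finset.smul_sum]
      exact Finset.sum_congr rfl fun q _ => by rw [map_smul, smul_comm]
    have h3 : 𝒟.twistedAverage ρ r s' b (ρ x u - 𝒟.χ b x • u) =
        𝒟.twistedAverage ρ r s' b (ρ x u) - 𝒟.twistedAverage ρ r s' b (𝒟.χ b x • u) := by
      rw [𝒟.twistedAverage_eq, 𝒟.twistedAverage_eq, 𝒟.twistedAverage_eq, ← Finset.sum_sub_distrib]
      exact Finset.sum_congr rfl fun q _ => by rw [map_sub, smul_sub]
    rw [h3, h1, h2, sub_self]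
  | zero =>
    refine ⟨0, 0, fun r _ s' _ _ => ?_⟩
    haveI := @Fintype.ofFinite _ (𝒟.finite_quotient r s')
    rw [𝒟.twistedAverage_eq]
    simp
  | add x y _ _ ihx ihy =>
    obtain ⟨r₁, s₁, h₁⟩ := ihx
    obtain ⟨r₂, s₂, h₂⟩ := ihy
    refine ⟨max r₁ r₂, min s₁ s₂, fun r hr s' hs' hb => ?_⟩
    haveI := @Fintype.ofFinite _ (𝒟.finite_quotient r s')
    have hadd : 𝒟.twistedAverage ρ r s' b (x + y) =
        𝒟.twistedAverage ρ r s' b x + 𝒟.twistedAverage ρ r s' b y := by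
      rw [𝒟.twistedAverage_eq, 𝒟.twistedAverage_eq, 𝒟.twistedAverage_eq, ← Finset.sum_add_distrib]
      exact Finset.sum_congr rfl fun q _ => by rw [map_add, smul_add]
    rw [hadd, h₁ r ((le_max_left _ _).trans hr) s' (hs'.trans (min_le_left _ _)) hb,
      h₂ r ((le_max_right _ _).trans hr) s' (hs'.trans (min_le_right _ _)) hb, add_zero]
  | smul a x _ ihx =>
    obtain ⟨r₁, s₁, h₁⟩ := ihx
    refine ⟨r₁, s₁, fun r hr s' hs' hb => ?_⟩
    haveI := @Fintype.ofFinite _ (𝒟.finite_quotient r s')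
    have hsmul : 𝒟.twistedAverage ρ r s' b (a • x) = a • 𝒟.twistedAverage ρ r s' b x := by
      rw [𝒟.twistedAverage_eq, 𝒟.twistedAverage_eq, Finset.smul_sum]
      exact Finset.sum_congr rfl fun q _ => by rw [map_smul, smul_comm]
    rw [hsmul, h₁ r hr s' hs' hb, smul_zero]

end Algebra

/-! ### Finite Fourier inversion -/

section Fourier

/-- **A non-trivial character sums to zero** over the finite quotient `D s / D R`: if
`x ∈ L R` and `χ b₀ x ≠ 1` for some `b₀ ∈ D s`, then `∑_{β ∈ D s / D R} χ β̃ x = 0`. [folklore] -/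
theorem sum_χ_eq_zero {s R : ℤ} [Fintype (𝒟.D s ⧸ (𝒟.D R).addSubgroupOf (𝒟.D s))] {x : A}
    (hx : x ∈ 𝒟.L R) {b₀ : B} (hb₀ : b₀ ∈ 𝒟.D s) (hne : 𝒟.χ b₀ x ≠ 1) :
    ∑ β : 𝒟.D s ⧸ (𝒟.D R).addSubgroupOf (𝒟.D s), 𝒟.χ ((β.out : 𝒟.D s) : B) x = 0 := by
  set S := ∑ β : 𝒟.D s ⧸ (𝒟.D R).addSubgroupOf (𝒟.D s), 𝒟.χ ((β.out : 𝒟.D s) : B) x with hS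
  have hconst : ∀ {c c' : 𝒟.D s}, (c : 𝒟.D s ⧸ (𝒟.D R).addSubgroupOf (𝒟.D s)) = c' →
      𝒟.χ (c : B) x = 𝒟.χ (c' : B) x := by
    intro c c' h
    have hmem : -(c : B) + c' ∈ 𝒟.D R := by
      have := QuotientAddGroup.eq.1 h
      rwa [AddSubgroup.mem_addSubgroupOf] at this
    have h1 : 𝒟.χ (-(c : B) + c') x = 1 := 𝒟.χ_eq_one_of_mem_D hmem hx
    have h2 : 𝒟.χ (-(c : B)) x * 𝒟.χ (c : B) x = 1 := by
      rw [← 𝒟.χ_add_left, neg_add_cancel, 𝒟.χ_zero_left]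
    rw [𝒟.χ_add_left] at h1
    calc 𝒟.χ (c : B) x = 𝒟.χ (c : B) x * (𝒟.χ (-(c : B)) x * 𝒟.χ (c' : B) x) := by rw [h1, mul_one]
      _ = 𝒟.χ (-(c : B)) x * 𝒟.χ (c : B) x * 𝒟.χ (c' : B) x := by ring
      _ = 𝒟.χ (c' : B) x := by rw [h2, one_mul]
  have hshift : S = 𝒟.χ b₀ x * S := by
    set c : 𝒟.D s ⧸ (𝒟.D R).addSubgroupOf (𝒟.D s) :=
      QuotientAddGroup.mk (s := (𝒟.D R).addSubgroupOf (𝒟.D s)) (⟨b₀, hb₀⟩ : 𝒟.D s) with hc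
    calc S = ∑ β : 𝒟.D s ⧸ (𝒟.D R).addSubgroupOf (𝒟.D s),
          𝒟.χ (((Equiv.addLeft c β).out : 𝒟.D s) : B) x := by
            rw [hS]; exact (Equiv.sum_comp (Equiv.addLeft c) _).symm
      _ = ∑ β : 𝒟.D s ⧸ (𝒟.D R).addSubgroupOf (𝒟.D s), 𝒟.χ b₀ x * 𝒟.χ ((β.out : 𝒟.D s) : B) x := by
            refine Finset.sum_congr rfl fun β _ => ?_
            rw [Equiv.coe_addLeft]
            have hcl : ((⟨b₀, hb₀⟩ + β.out : 𝒟.D s) : 𝒟.D s ⧸ (𝒟.D R).addSubgroupOf (𝒟.D s)) =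
                (c + β).out := by
              rw [QuotientAddGroup.mk_add, QuotientAddGroup.out_eq', hc, QuotientAddGroup.out_eq']
            rw [← hconst hcl, AddSubgroup.coe_add, 𝒟.χ_add_left]
      _ = 𝒟.χ b₀ x * S := by rw [hS, Finset.mul_sum]
  have : (1 - 𝒟.χ b₀ x) * S = 0 := by rw [sub_mul, one_mul, ← hshift, sub_self]
  rcases mul_eq_zero.1 this with h | h
  · exact absurd (sub_eq_zero.1 h).symm hne
  · exact h

/-- **Finite Fourier inversion.** If `v` is fixed by `L s` and `s ≤ R`, then summing the twisted
averages `e^{(R)}_{s,b} v` over `b ∈ D s / D R` returns `[D s : D R] • v`: the coefficient of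
`ρ(q̃) v` is the character sum `∑_β χ β̃ (-q̃)`, which is `[D s : D R]` for `q̃ ∈ L s` and `0`
otherwise by the separation property of the datum. (Bump 1997, §4.4, p. 463: Fourier inversion
on `𝔭^{-k}/𝔭^{n+k}` in the proof that `𝒮(V)` has the right stalks.)
[cite: Bump1997, Proposition 4.4.5 (PDF p. 464)] -/
theorem sum_twistedAverage_eq_card_smul {s R : ℤ}
    [Fintype (𝒟.D s ⧸ (𝒟.D R).addSubgroupOf (𝒟.D s))] {v : V} (hv : ∀ x ∈ 𝒟.L s, ρ x v = v) :
    ∑ β : 𝒟.D s ⧸ (𝒟.D R).addSubgroupOf (𝒟.D s), 𝒟.twistedAverage ρ R s ((β.out : 𝒟.D s) : B) v =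
      Fintype.card (𝒟.D s ⧸ (𝒟.D R).addSubgroupOf (𝒟.D s)) • v := by
  haveI := @Fintype.ofFinite _ (𝒟.finite_quotient R s)
  simp_rw [𝒟.twistedAverage_eq ρ R s]
  rw [Finset.sum_comm]
  simp_rw [← Finset.sum_smul]
  -- only the coset of `0` contributes
  set q₀ : 𝒟.L R ⧸ (𝒟.L s).addSubgroupOf (𝒟.L R) := 0 with hq₀
  have hq₀out : ((q₀.out : 𝒟.L R) : A) ∈ 𝒟.L s := by
    have : (q₀.out : 𝒟.L R ⧸ (𝒟.L s).addSubgroupOf (𝒟.L R)) = 0 := QuotientAddGroup.out_eq' q₀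
    rw [QuotientAddGroup.eq_zero_iff, AddSubgroup.mem_addSubgroupOf] at this
    exact this
  rw [Finset.sum_eq_single q₀]
  · have hχ : ∀ β : 𝒟.D s ⧸ (𝒟.D R).addSubgroupOf (𝒟.D s),
        𝒟.χ ((β.out : 𝒟.D s) : B) (-((q₀.out : 𝒟.L R) : A)) = 1 := fun β =>
      𝒟.χ_eq_one_of_mem_D (β.out).2 ((𝒟.L s).neg_mem hq₀out)
    simp only [hχ]
    rw [Finset.sum_const, Finset.card_univ, hv _ hq₀out, Nat.smul_one_eq_cast, Nat.cast_smul_eq_nsmul]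
  · intro q _ hq
    have hqs : ((q.out : 𝒟.L R) : A) ∉ 𝒟.L s := by
      intro hmem
      apply hq
      have : (q.out : 𝒟.L R ⧸ (𝒟.L s).addSubgroupOf (𝒟.L R)) = q := QuotientAddGroup.out_eq' q
      rw [← this, hq₀, QuotientAddGroup.eq_zero_iff, AddSubgroup.mem_addSubgroupOf]
      exact hmem
    have hqs' : -((q.out : 𝒟.L R) : A) ∉ 𝒟.L s := fun h => hqs (by simpa using (𝒟.L s).neg_mem h)
    obtain ⟨b₀, hb₀, hne⟩ := 𝒟.sep s _ hqs'
    rw [𝒟.sum_χ_eq_zero ((𝒟.L R).neg_mem (q.out).2) hb₀ hne, zero_smul]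
  · exact fun h => absurd (Finset.mem_univ q₀) h

end Fourier

/-! ### The stalk theorem -/

variable [IsTopologicalAddGroup B] [CharZero k]

/-- **A non-zero smooth `A`-module has a non-zero twisted costalk** (pointed, relative form).
Let `𝒟` be a stalk datum, `ρ` an additive action of `A` on the `k`-vector space `V`
(`ρ (x + y) = ρ x ∘ ρ y`, `char k = 0`) which is smooth for `𝒟` (every vector is fixed by some
lattice `L s`), `W` a `ρ`-stable subspace and `v ∉ W`. Then for some parameter `b` the vector `v`
does not lie in `W + V(A, χ_b)`, `V(A, χ_b) = ⟨ρ(x) u - χ b x • u⟩`; in particular the space of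
`χ_b`-twisted coinvariants of `V / W` is non-zero. For `A = N(F) ≅ F` acting on a smooth
`B(F)`-module this is the statement that a non-zero cosmooth module has a non-zero stalk
`𝒮(V)_a = J_{ψ_a}(V)` (Bump 1997, Props. 4.3.12–4.3.13 and 4.4.5, used in the proof of
Thm. 4.4.3); for `A = V_n ≅ F^{n-1} ≤ P_n` it is the existence of a non-zero derivative
(Bernstein–Zelevinsky 1976, §5). Proof: twisted averages, the easy half of Prop. 4.4.1,
compactness of `D s` and finite Fourier inversion (module docstring).
[cite: Bump1997, Theorem 4.4.3 (PDF p. 464)] -/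
theorem exists_notMem_sup_twistedSpan (hρ : ∀ x y, ρ (x + y) = ρ x ∘ₗ ρ y)
    (hsm : ∀ v : V, ∃ s, ∀ x ∈ 𝒟.L s, ρ x v = v) {W : Submodule k V} (hW : ∀ x, ∀ w ∈ W, ρ x w ∈ W) {v : V} (hv : v ∉ W) :
    ∃ b : B, v ∉ W ⊔ Submodule.span k {w | ∃ x u, w = ρ x u - 𝒟.χ b x • u} := by
  classical
  by_contra hall
  push Not at hall
  obtain ⟨s, hs⟩ := hsm v
  have hfinL : ∀ r s₁ : ℤ, Fintype (𝒟.L r ⧸ (𝒟.L s₁).addSubgroupOf (𝒟.L r)) := fun r s₁ =>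
    @Fintype.ofFinite _ (𝒟.finite_quotient r s₁)
  have hcardL : ∀ r s₁ : ℤ, (Fintype.card (𝒟.L r ⧸ (𝒟.L s₁).addSubgroupOf (𝒟.L r)) : k) ≠ 0 :=
    fun r s₁ => Nat.cast_ne_zero.2 Fintype.card_ne_zero
  -- Step 1: for `b ∈ D s`, the twisted averages `e^{(r)}_{s,b} v` lie in `W` for `r` large.
  have step1 : ∀ b ∈ 𝒟.D s, ∃ r₀, ∀ r, r₀ ≤ r → 𝒟.twistedAverage ρ r s b v ∈ W := by
    intro b hb
    obtain ⟨w, hw, t, ht, hwt⟩ := Submodule.mem_sup.1 (hall b)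
    obtain ⟨r₀, s₀, h⟩ := 𝒟.exists_twistedAverage_eq_zero ρ hρ hsm b ht
    refine ⟨r₀, fun r hr => ?_⟩
    set s' := min s₀ s with hs'def
    have hs' : s' ≤ s := min_le_right _ _
    have hb' : b ∈ 𝒟.D s' := 𝒟.D_anti hs' hb
    have ht0 : 𝒟.twistedAverage ρ r s' b t = 0 := h r hr s' (min_le_left _ _) hb'
    have hv' : 𝒟.twistedAverage ρ r s' b v ∈ W := by
      have hadd : 𝒟.twistedAverage ρ r s' b (w + t) =
          𝒟.twistedAverage ρ r s' b w + 𝒟.twistedAverage ρ r s' b t := by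
        rw [𝒟.twistedAverage_eq, 𝒟.twistedAverage_eq, 𝒟.twistedAverage_eq,
          ← Finset.sum_add_distrib]
        exact Finset.sum_congr rfl fun q _ => by rw [map_add, smul_add]
      rw [← hwt, hadd, ht0, add_zero]
      exact 𝒟.twistedAverage_mem ρ hW r s' b hw
    have hcomm := 𝒟.card_smul_twistedAverage_comm ρ hρ (r := r) hs' hb hs
    have : 𝒟.twistedAverage ρ r s b v =
        ((Fintype.card (𝒟.L r ⧸ (𝒟.L s').addSubgroupOf (𝒟.L r)) : k)⁻¹ *
          (Fintype.card (𝒟.L r ⧸ (𝒟.L s).addSubgroupOf (𝒟.L r)) : k)) •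
          𝒟.twistedAverage ρ r s' b v := by
      rw [mul_smul, Nat.cast_smul_eq_nsmul, ← hcomm, ← Nat.cast_smul_eq_nsmul k,
        inv_smul_smul₀ (hcardL r s')]
    rw [this]
    exact W.smul_mem _ hv'
  -- Step 2: the sets `U r = {b | e^{(r)}_{s,b} v ∈ W}` are open and increase on `D s`.
  set U : ℤ → Set B := fun r => {b | 𝒟.twistedAverage ρ r s b v ∈ W} with hU
  have hUopen : ∀ r, IsOpen (U r) := by
    intro r
    refine isOpen_iff_mem_nhds.2 fun b hb => ?_
    have hpre : (fun x => x - b) ⁻¹' (𝒟.D r : Set B) ⊆ U r := by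
      intro x hx
      have : x = b + (x - b) := by abel
      change 𝒟.twistedAverage ρ r s x v ∈ W
      rw [this, 𝒟.twistedAverage_add_of_mem_D ρ hx]
      exact hb
    refine Filter.mem_of_superset ?_ hpre
    exact (continuous_sub_right b).continuousAt.preimage_mem_nhds
      ((𝒟.isOpen_D r).mem_nhds (by simp [(𝒟.D r).zero_mem]))
  have hUmono : ∀ {r r'}, r ≤ r' → ∀ b ∈ 𝒟.D s, b ∈ U r → b ∈ U r' := by
    intro r r' hrr' b hbD hbU
    change 𝒟.twistedAverage ρ r' s b v ∈ W
    have h := 𝒟.twistedAverage_twistedAverage ρ hρ hrr' hbD hs (r := r)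
    have hmem : 𝒟.twistedAverage ρ r' s b (𝒟.twistedAverage ρ r s b v) ∈ W :=
      𝒟.twistedAverage_mem ρ hW r' s b hbU
    rw [h, ← Nat.cast_smul_eq_nsmul k] at hmem
    have := W.smul_mem ((Fintype.card (𝒟.L r ⧸ (𝒟.L s).addSubgroupOf (𝒟.L r)) : k)⁻¹) hmem
    rwa [inv_smul_smul₀ (hcardL r s)] at this
  -- Step 3: compactness of `D s` gives one `R ≥ s` with `D s ⊆ U R`.
  obtain ⟨R, -, hR⟩ : ∃ R, s ≤ R ∧ ∀ b ∈ 𝒟.D s, b ∈ U R := by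
    have hcover : (𝒟.D s : Set B) ⊆ ⋃ i : {r : ℤ // s ≤ r}, U i := by
      intro b hb
      obtain ⟨r₀, hr₀⟩ := step1 b hb
      exact Set.mem_iUnion.2 ⟨⟨max r₀ s, le_max_right _ _⟩, hr₀ _ (le_max_left _ _)⟩
    obtain ⟨t, ht⟩ := (𝒟.isCompact_D s).elim_finite_subcover (fun i : {r : ℤ // s ≤ r} => U i)
      (fun i => hUopen i) hcover
    refine ⟨s + ∑ i ∈ t, (i.1 - s), ?_, fun b hb => ?_⟩
    · have : 0 ≤ ∑ i ∈ t, ((i : {r : ℤ // s ≤ r}).1 - s) :=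
        Finset.sum_nonneg fun i _ => sub_nonneg.2 i.2
      linarith
    · obtain ⟨i, hi, hbi⟩ : ∃ i ∈ t, b ∈ U i := by
        have := ht hb
        simp only [Set.mem_iUnion, exists_prop] at this
        exact this
      refine hUmono ?_ b hb hbi
      have : (i : ℤ) - s ≤ ∑ j ∈ t, ((j : {r : ℤ // s ≤ r}).1 - s) :=
        Finset.single_le_sum (fun j _ => sub_nonneg.2 j.2) hi
      linarith
  -- Step 4: Fourier inversion on `D s / D R` puts `v` in `W`.
  haveI : CompactSpace (𝒟.D s) := isCompact_iff_compactSpace.mp (𝒟.isCompact_D s)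
  haveI : Finite (𝒟.D s ⧸ (𝒟.D R).addSubgroupOf (𝒟.D s)) :=
    AddSubgroup.quotient_finite_of_isOpen _ (AddSubgroup.addSubgroupOf_isOpen _ _ (𝒟.isOpen_D R))
  haveI := Fintype.ofFinite (𝒟.D s ⧸ (𝒟.D R).addSubgroupOf (𝒟.D s))
  have hsum := 𝒟.sum_twistedAverage_eq_card_smul ρ (R := R) hs
  have hmem : (Fintype.card (𝒟.D s ⧸ (𝒟.D R).addSubgroupOf (𝒟.D s))) • v ∈ W := by
    rw [← hsum]
    exact W.sum_mem fun β _ => hR _ (β.out).2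
  rw [← Nat.cast_smul_eq_nsmul k] at hmem
  have := W.smul_mem ((Fintype.card (𝒟.D s ⧸ (𝒟.D R).addSubgroupOf (𝒟.D s)) : k)⁻¹) hmem
  rw [inv_smul_smul₀ (Nat.cast_ne_zero.2 Fintype.card_ne_zero)] at this
  exact hv this

end Action

end StalkDatum

end Literature.NumberTheory.Automorphic
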